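/-
COR-CM (cell pub-hodgecm2, stage 2 of the Hodge ladder) — count-neutral KERNEL COMBINATORICS «dicyclic twist: the dictionary with the intrinsic currency»
(seat prover-pub-hodgecm2-b23-g42-0, binder prover b23, gen 42; claim DICYCLIC-COLUMN, HOME/INBOX.md l.10328).
Bookkeeping definitions with bodies (`Datum`, `ty`, `typeSetOf`, `typeOf`, `typeEquiv`) + theorems, on top of the intrinsic currency
`CorCM/Prior/AllgGroup1.lean` / `Census/BlockParityLaw.lean` and part I of the lane (`Census/DicyclicTwistModel.lean`) used BY NAME; no `decide` table,
no certificate, no named fact, no `sorry`; `Interfaces.lean` (C1), every E term, B01, `Transposition/*`, `PortJoin/*` untouched.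
HONEST FRAMING: `HC_CM` is NOT proved, here or anywhere in the tree; nothing here is a period, a count of record or a headline.
T5: n/a-class (the only hypothesis binders are the fields of the dicyclic datum and `c * c = 1`); checker: self, 2026-08-23.
-/
import Summits.HodgeConjecture.CorCM.Census.BlockParityLaw
import Summits.HodgeConjecture.CorCM.Census.DicyclicTwistModel

/-!
# The dicyclic twist, dictionary: abstract CM types of `(G, c)` along a dicyclic datum ≃ pairs of labels `(A → ℤ/2) × (A → ℤ/2)`

Let `G` be a finite group and `c ∈ G`.  A DICYCLIC DATUM on `(G, c)` over the additive group `A` (`Datum G c A`) is an embedded copy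
`ι : ℤ/2 × A ↪ G` (`ι (a + b) = ι a · ι b`, `ι (1,0) = c`) together with an element `x ∉ ι(ℤ/2 × A)` inverting it (`x · ι a = ι (−a) · x`) with
`x² = c`, the two cosets `ι(ℤ/2 × A) ⊔ x·ι(ℤ/2 × A)` exhausting `G`: so `G ≅ Dic(ℤ/2 × A, c)` is the generalised dicyclic group of the abelian group
`ℤ/2 × A` at the involution `c` (for `A = ℤ/m`, `m` odd: the dicyclic group `Dic_m` of order `4m`; `c` is a square, the twisted column of the census).
Along such a datum the abstract CM types `CMF G c` (`Ψ ⊔ cΨ = G`) are the pairs of labels of part I of the lane (`Census/DicyclicTwistModel.lean`):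

  `ty Ψ = (s ↦ [ι(0,s) ∉ Ψ], s ↦ [x·ι(0,s) ∉ Ψ]) ∈ Ty A × Ty A`, i.e. `ι(e,s) ∈ Ψ ↔ (ty Ψ).1 s = e`, `x·ι(e,s) ∈ Ψ ↔ (ty Ψ).2 s = e`

(§2, **`typeEquiv : CMF G c ≃ Ty₂ A`**), and the dictionary reads:
* §3 **base change is the model's motion**: `ty (Ψ·(ι a)⁻¹) = twH a (ty Ψ)` (diagonal twist), **`ty (Ψ·x⁻¹) = twX (ty Ψ)`**
  (`(ψ₀, ψ₁) ↦ (ψ₁(−·), ψ₀(−·) + 1)`), conjugation `Ψ·c = twH (1,0) = conj`;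
Part `Census/DicyclicTwistPlaces.lean` reads places and flips (faces), part `Census/DicyclicTwistTransport.lean` transports faces, pairs, translates
and blocks and concludes `μ(G, c) ≤ β(G, c) − 1` in the intrinsic currency from part XI (`Census/DicyclicTwistCount.lean`).
All [folklore] (Pohlmann's dictionary [Pohlmann1968, Thm 1] specialised to an index-two inversion twist).

## References
* [Pohlmann1968] H. Pohlmann, Algebraic cycles on abelian varieties of complex multiplication type, Ann. of Math. 88 (1968), Thm 1.
* [Milne1999] J. S. Milne, Lefschetz motives and the Tate conjecture, Compositio Math. 117 (1999), Prop. 2.1, p. 54.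
-/

namespace Summit.HodgeConjecture.CorCM.Census.DicyclicTwist

open Finset
open Summit.HodgeConjecture.CorCM.Prior.AllgGroup.RfwfAllgGroup
open Summit.HodgeConjecture.CorCM.Census.BlockParity
open Summit.HodgeConjecture.CorCM.Census.OddSliceFacesModel

noncomputable section

/-- **A dicyclic datum on `(G, c)` over `A`**: an embedded copy `ι` of `ℤ/2 × A` with `ι (1,0) = c`, and `x` outside it with `x·ι a = ι(−a)·x`,
`x² = c`, the two cosets exhausting `G` (`G ≅ Dic(ℤ/2 × A, c)`). [folklore] -/
structure Datum (G : Type*) [Group G] (c : G) (A : Type) [AddCommGroup A] where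
  /-- the embedding of `ℤ/2 × A` -/
  ι : ZMod 2 × A → G
  /-- the twisting element -/
  x : G
  /-- `ι` is multiplicative-to-additive -/
  map_add : ∀ a b, ι (a + b) = ι a * ι b
  /-- `ι (1,0) = c` -/
  map_c : ι (1, 0) = c
  /-- `x` inverts `ι` by conjugation -/
  x_mul : ∀ a, x * ι a = ι (-a) * x
  /-- `x² = c` -/
  x_mul_x : x * x = c
  /-- `ι` is injective -/
  inj : Function.Injective ι
  /-- `x ∉ ι(ℤ/2 × A)` -/
  x_ne : ∀ a, x ≠ ι a
  /-- the two cosets exhaust `G` -/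
  exhaust : ∀ g : G, ∃ a, g = ι a ∨ g = x * ι a

variable {G : Type*} [Group G] [Fintype G] [DecidableEq G] {c : G}
variable {A : Type} [AddCommGroup A] [Fintype A] [DecidableEq A]
variable (D : Datum G c A)

/-! ## §1 First consequences of the datum -/

omit [Fintype G] [DecidableEq G] [Fintype A] [DecidableEq A] in
/-- `ι 0 = 1`. [folklore] -/
theorem ι_zero : D.ι 0 = 1 := by
  have h := D.map_add 0 0
  rw [add_zero] at h
  exact mul_left_cancel (a := D.ι 0) (by rw [← h, mul_one])

omit [Fintype G] [DecidableEq G] [Fintype A] [DecidableEq A] in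
/-- `ι (−a) = (ι a)⁻¹`. [folklore] -/
theorem ι_neg (a : ZMod 2 × A) : D.ι (-a) = (D.ι a)⁻¹ :=
  eq_inv_of_mul_eq_one_left (by rw [← D.map_add, neg_add_cancel, ι_zero])

omit [Fintype G] [DecidableEq G] [Fintype A] [DecidableEq A] in
/-- `ι` is commutative. [folklore] -/
theorem ι_comm (a b : ZMod 2 × A) : D.ι a * D.ι b = D.ι b * D.ι a := by
  rw [← D.map_add, ← D.map_add, add_comm]

omit [Fintype G] [DecidableEq G] [Fintype A] [DecidableEq A] in
/-- `c · ι a = ι ((1,0) + a)`. [folklore] -/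
theorem c_mul_ι (a : ZMod 2 × A) : c * D.ι a = D.ι ((1, 0) + a) := by
  rw [D.map_add, D.map_c]

omit [Fintype G] [DecidableEq G] [Fintype A] [DecidableEq A] in
/-- `c · ι (e, s) = ι (e + 1, s)`. [folklore] -/
theorem c_mul_ι_mk (e : ZMod 2) (s : A) : c * D.ι (e, s) = D.ι (e + 1, s) := by
  rw [c_mul_ι, Prod.mk_add_mk, zero_add, add_comm]

omit [Fintype G] [DecidableEq G] [Fintype A] [DecidableEq A] in
/-- `x` commutes with `c = x²`. [folklore] -/
theorem x_mul_c : D.x * c = c * D.x := by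
  have h : D.x * (D.x * D.x) = D.x * D.x * D.x := (mul_assoc _ _ _).symm
  rwa [D.x_mul_x] at h

omit [Fintype G] [DecidableEq G] [Fintype A] [DecidableEq A] in
/-- `ι a` commutes with `c`. [folklore] -/
theorem ι_mul_c (a : ZMod 2 × A) : D.ι a * c = c * D.ι a := by
  have h : D.ι a * D.ι (1, 0) = D.ι (1, 0) * D.ι a := ι_comm D a (1, 0)
  rwa [D.map_c] at h

omit [Fintype G] [DecidableEq G] [Fintype A] [DecidableEq A] in
include D in
/-- **`c` is central.** [folklore] -/
theorem mul_c_comm (g : G) : g * c = c * g := by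
  obtain ⟨a, rfl | rfl⟩ := D.exhaust g
  · exact ι_mul_c D a
  · rw [mul_assoc, ι_mul_c, ← mul_assoc, x_mul_c, mul_assoc]

omit [Fintype G] [DecidableEq G] [Fintype A] [DecidableEq A] in
/-- `ι a · x = x · ι (−a)`. [folklore] -/
theorem ι_mul_x (a : ZMod 2 × A) : D.ι a * D.x = D.x * D.ι (-a) := by
  rw [D.x_mul, neg_neg]

omit [Fintype G] [DecidableEq G] [Fintype A] [DecidableEq A] in
/-- `(x·ι a)·(ι b) = x·ι (a + b)`. [folklore] -/
theorem xι_mul_ι (a b : ZMod 2 × A) : D.x * D.ι a * D.ι b = D.x * D.ι (a + b) := by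
  rw [mul_assoc, ← D.map_add]

omit [Fintype G] [DecidableEq G] [Fintype A] [DecidableEq A] in
/-- `(ι a)·(x·ι b) = x·ι (b − a)`. [folklore] -/
theorem ι_mul_xι (a b : ZMod 2 × A) : D.ι a * (D.x * D.ι b) = D.x * D.ι (b - a) := by
  rw [← mul_assoc, ι_mul_x, mul_assoc, ← D.map_add, neg_add_eq_sub]

omit [Fintype G] [DecidableEq G] [Fintype A] [DecidableEq A] in
/-- `(x·ι a)·(x·ι b) = ι ((1,0) + (b − a))`. [folklore] -/
theorem xι_mul_xι (a b : ZMod 2 × A) : D.x * D.ι a * (D.x * D.ι b) = D.ι ((1, 0) + (b - a)) := by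
  rw [mul_assoc, ι_mul_xι, ← mul_assoc, D.x_mul_x, c_mul_ι]

omit [Fintype G] [DecidableEq G] [Fintype A] [DecidableEq A] in
/-- The two cosets are disjoint: `ι a ≠ x·ι b`. [folklore] -/
theorem ι_ne_xι (a b : ZMod 2 × A) : D.ι a ≠ D.x * D.ι b := by
  intro h
  apply D.x_ne (a - b)
  rw [sub_eq_add_neg, D.map_add, h, mul_assoc, ← D.map_add, add_neg_cancel, ι_zero, mul_one]

omit [Fintype G] [DecidableEq G] [Fintype A] [DecidableEq A] in
/-- `x·ι` is injective. [folklore] -/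
theorem xι_injective : Function.Injective fun a => D.x * D.ι a := fun _ _ h => D.inj (mul_left_cancel h)

/-! ## §2 Labels of abstract CM types and the dictionary -/

/-- **The pair of labels** of an abstract CM type: `(ty Ψ).1 s = [ι(0,s) ∉ Ψ]`, `(ty Ψ).2 s = [x·ι(0,s) ∉ Ψ]`. [folklore] -/
def ty (Ψ : CMF G c) : Ty₂ A :=
  (fun s => if D.ι (0, s) ∈ Ψ.1 then 0 else 1, fun s => if D.x * D.ι (0, s) ∈ Ψ.1 then 0 else 1)

/-- `ℤ/2` has two elements. [folklore] -/
private theorem zmod2_cases : ∀ e : ZMod 2, e = 0 ∨ e = 1 := by decide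

/-- Two elements of `ℤ/2` that vanish together are equal. [folklore] -/
private theorem zmod2_eq_of_iff : ∀ {u v : ZMod 2}, (u = 0 ↔ v = 0) → u = v := by decide

/-- `u = e ↔ u + e = 0` in `ℤ/2`. [folklore] -/
private theorem eq_iff_add_eq_zero : ∀ u e : ZMod 2, u = e ↔ u + e = 0 := by decide

omit [Fintype A] [DecidableEq A] in
/-- **Membership of `ι(e,s)`**: `ι (e, s) ∈ Ψ ↔ (ty Ψ).1 s = e`. [folklore] -/
theorem ι_mem_iff (Ψ : CMF G c) (e : ZMod 2) (s : A) : D.ι (e, s) ∈ Ψ.1 ↔ (ty D Ψ).1 s = e := by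
  have hcm : D.ι (1, s) ∈ Ψ.1 ↔ D.ι (0, s) ∉ Ψ.1 := by
    have h := Ψ.2 (D.ι (0, s))
    rw [c_mul_ι_mk, zero_add] at h
    tauto
  rcases zmod2_cases e with rfl | rfl
  · simp only [ty]; split_ifs with h <;> simp [h]
  · rw [hcm]; simp only [ty]; split_ifs with h <;> simp [h]

omit [Fintype A] [DecidableEq A] in
/-- **Membership of `x·ι(e,s)`**: `x·ι (e, s) ∈ Ψ ↔ (ty Ψ).2 s = e`. [folklore] -/
theorem xι_mem_iff (Ψ : CMF G c) (e : ZMod 2) (s : A) : D.x * D.ι (e, s) ∈ Ψ.1 ↔ (ty D Ψ).2 s = e := by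
  have hcm : D.x * D.ι (1, s) ∈ Ψ.1 ↔ D.x * D.ι (0, s) ∉ Ψ.1 := by
    have h := Ψ.2 (D.x * D.ι (0, s))
    rw [← mul_assoc, ← x_mul_c, mul_assoc, c_mul_ι_mk, zero_add] at h
    tauto
  rcases zmod2_cases e with rfl | rfl
  · simp only [ty]; split_ifs with h <;> simp [h]
  · rw [hcm]; simp only [ty]; split_ifs with h <;> simp [h]

/-- The underlying set of the abstract CM type of a pair of labels: `{ι(e,s) | ψ₀ s = e} ⊔ {x·ι(e,s) | ψ₁ s = e}`. [folklore] -/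
def typeSetOf (Ψm : Ty₂ A) : Finset G :=
  univ.filter fun g => (∃ a : ZMod 2 × A, g = D.ι a ∧ Ψm.1 a.2 = a.1) ∨ (∃ a : ZMod 2 × A, g = D.x * D.ι a ∧ Ψm.2 a.2 = a.1)

omit [DecidableEq A] in
/-- Membership of `ι a` in the set of a pair of labels. [folklore] -/
theorem ι_mem_typeSetOf (Ψm : Ty₂ A) (a : ZMod 2 × A) : D.ι a ∈ typeSetOf D Ψm ↔ Ψm.1 a.2 = a.1 := by
  simp only [typeSetOf, mem_filter, mem_univ, true_and]
  constructor
  · rintro (⟨a', h, h'⟩ | ⟨a', h, -⟩)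
    · rw [D.inj h]; exact h'
    · exact absurd h (ι_ne_xι D a a')
  · exact fun h => Or.inl ⟨a, rfl, h⟩

omit [DecidableEq A] in
/-- Membership of `x·ι a` in the set of a pair of labels. [folklore] -/
theorem xι_mem_typeSetOf (Ψm : Ty₂ A) (a : ZMod 2 × A) : D.x * D.ι a ∈ typeSetOf D Ψm ↔ Ψm.2 a.2 = a.1 := by
  simp only [typeSetOf, mem_filter, mem_univ, true_and]
  constructor
  · rintro (⟨a', h, -⟩ | ⟨a', h, h'⟩)
    · exact absurd h.symm (ι_ne_xι D a' a)
    · rw [xι_injective D h]; exact h'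
  · exact fun h => Or.inr ⟨a, rfl, h⟩

/-- The CM-type axiom in `ℤ/2`: `u = e ↔ ¬ u = e + 1`. [folklore] -/
private theorem eq_iff_not_eq_add_one : ∀ u e : ZMod 2, u = e ↔ ¬ u = e + 1 := by decide

omit [DecidableEq A] in
/-- The set of a pair of labels is an abstract CM type. [folklore] -/
theorem isCMF_typeSetOf (Ψm : Ty₂ A) : IsCMF c (typeSetOf D Ψm) := by
  intro g
  obtain ⟨⟨e, s⟩, rfl | rfl⟩ := D.exhaust g
  · rw [c_mul_ι_mk, ι_mem_typeSetOf, ι_mem_typeSetOf]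
    exact eq_iff_not_eq_add_one _ _
  · rw [← mul_assoc, ← x_mul_c, mul_assoc, c_mul_ι_mk, xι_mem_typeSetOf, xι_mem_typeSetOf]
    exact eq_iff_not_eq_add_one _ _

/-- **The abstract CM type of a pair of labels.** [folklore] -/
def typeOf (Ψm : Ty₂ A) : CMF G c := ⟨typeSetOf D Ψm, isCMF_typeSetOf D Ψm⟩

omit [DecidableEq A] in
/-- `ι a ∈ typeOf (ψ₀, ψ₁) ↔ ψ₀ a.2 = a.1`. [folklore] -/
theorem ι_mem_typeOf (Ψm : Ty₂ A) (a : ZMod 2 × A) : D.ι a ∈ (typeOf D Ψm).1 ↔ Ψm.1 a.2 = a.1 := ι_mem_typeSetOf D Ψm a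

omit [DecidableEq A] in
/-- `x·ι a ∈ typeOf (ψ₀, ψ₁) ↔ ψ₁ a.2 = a.1`. [folklore] -/
theorem xι_mem_typeOf (Ψm : Ty₂ A) (a : ZMod 2 × A) : D.x * D.ι a ∈ (typeOf D Ψm).1 ↔ Ψm.2 a.2 = a.1 := xι_mem_typeSetOf D Ψm a

omit [DecidableEq A] in
/-- `ty ∘ typeOf = id`. [folklore] -/
theorem ty_typeOf (Ψm : Ty₂ A) : ty D (typeOf D Ψm) = Ψm := by
  obtain ⟨ψ₀, ψ₁⟩ := Ψm
  refine Prod.ext (funext fun s => zmod2_eq_of_iff ?_) (funext fun s => zmod2_eq_of_iff ?_)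
  · rw [← ι_mem_iff, ι_mem_typeOf]
  · rw [← xι_mem_iff, xι_mem_typeOf]

omit [DecidableEq A] in
/-- `typeOf ∘ ty = id`. [folklore] -/
theorem typeOf_ty (Ψ : CMF G c) : typeOf D (ty D Ψ) = Ψ := by
  apply Subtype.ext
  ext g
  obtain ⟨⟨e, s⟩, rfl | rfl⟩ := D.exhaust g
  · rw [ι_mem_typeOf, ι_mem_iff]
  · rw [xι_mem_typeOf, xι_mem_iff]

/-- **THE DICTIONARY**: abstract CM types of `(G, c)` ≃ pairs of labels. [folklore] -/
def typeEquiv : CMF G c ≃ Ty₂ A where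
  toFun := ty D
  invFun := typeOf D
  left_inv := typeOf_ty D
  right_inv := ty_typeOf D

omit [DecidableEq A] in
/-- `typeEquiv Ψ = ty Ψ`. [folklore] -/
@[simp] theorem typeEquiv_apply (Ψ : CMF G c) : typeEquiv D Ψ = ty D Ψ := rfl

omit [DecidableEq A] in
/-- `typeEquiv⁻¹ Ψm = typeOf Ψm`. [folklore] -/
@[simp] theorem typeEquiv_symm_apply (Ψm : Ty₂ A) : (typeEquiv D).symm Ψm = typeOf D Ψm := rfl

omit [DecidableEq A] in
/-- `ty` is injective. [folklore] -/
theorem ty_injective : Function.Injective (ty (c := c) D) := (typeEquiv D).injective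

/-! ## §3 Base change is the model's motion -/

omit [Fintype A] [DecidableEq A] in
/-- **Base change along `ι a` is the diagonal twist**: `ty (Ψ·(ι a)⁻¹) = twH a (ty Ψ)`. [folklore] -/
theorem ty_rt_ι (a : ZMod 2 × A) (Ψ : CMF G c) : ty D (rt c (D.ι a) Ψ) = twH A a (ty D Ψ) := by
  have e1 : ∀ s : A, D.ι (0, s) * D.ι a = D.ι (a.1, s + a.2) := fun s => by
    rw [← D.map_add, Prod.mk_add_mk, zero_add]
  refine Prod.ext (funext fun s => zmod2_eq_of_iff ?_) (funext fun s => zmod2_eq_of_iff ?_)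
  · show (ty D (rt c (D.ι a) Ψ)).1 s = 0 ↔ (ty D Ψ).1 (s + a.2) + a.1 = 0
    rw [← ι_mem_iff, mem_rt, e1, ι_mem_iff]
    exact eq_iff_add_eq_zero _ _
  · show (ty D (rt c (D.ι a) Ψ)).2 s = 0 ↔ (ty D Ψ).2 (s + a.2) + a.1 = 0
    rw [← xι_mem_iff, mem_rt, mul_assoc, e1, xι_mem_iff]
    exact eq_iff_add_eq_zero _ _

omit [Fintype A] [DecidableEq A] in
/-- **Base change along `x` is the swap-twist**: `ty (Ψ·x⁻¹) = twX (ty Ψ) = ((ty Ψ).2 (−·), (ty Ψ).1 (−·) + 1)`. [folklore] -/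
theorem ty_rt_x (Ψ : CMF G c) : ty D (rt c D.x Ψ) = twX A (ty D Ψ) := by
  have e1 : ∀ s : A, D.ι (0, s) * D.x = D.x * D.ι (0, -s) := fun s => by
    rw [ι_mul_x, Prod.neg_mk, neg_zero]
  have e2 : ∀ s : A, D.x * D.ι (0, s) * D.x = D.ι (1, -s) := fun s => by
    rw [mul_assoc, e1, ← mul_assoc, D.x_mul_x, c_mul_ι_mk, zero_add]
  refine Prod.ext (funext fun s => zmod2_eq_of_iff ?_) (funext fun s => zmod2_eq_of_iff ?_)
  · show (ty D (rt c D.x Ψ)).1 s = 0 ↔ (ty D Ψ).2 (-s) = 0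
    rw [← ι_mem_iff, mem_rt, e1, xι_mem_iff]
  · show (ty D (rt c D.x Ψ)).2 s = 0 ↔ (ty D Ψ).1 (-s) + 1 = 0
    rw [← xι_mem_iff, mem_rt, e2, ι_mem_iff]
    exact eq_iff_add_eq_zero _ _

omit [Fintype A] [DecidableEq A] in
/-- Base change along `x·ι a`: `ty (Ψ·(x·ι a)⁻¹) = twX (twH a (ty Ψ))`. [folklore] -/
theorem ty_rt_xι (a : ZMod 2 × A) (Ψ : CMF G c) : ty D (rt c (D.x * D.ι a) Ψ) = twX A (twH A a (ty D Ψ)) := by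
  rw [rt_mul, ty_rt_x, ty_rt_ι]

omit [Fintype A] [DecidableEq A] in
/-- **Conjugation is the model's conjugation**: `ty (Ψ·c) = conj (ty Ψ)`. [folklore] -/
theorem ty_rt_c (Ψ : CMF G c) : ty D (rt c c Ψ) = conj A (ty D Ψ) := by
  rw [conj_eq_twH, ← ty_rt_ι, D.map_c]

omit [DecidableEq A] in
/-- Types of twisted labels: `typeOf (twH a Ψm) = (typeOf Ψm)·(ι a)⁻¹`. [folklore] -/
theorem typeOf_twH (a : ZMod 2 × A) (Ψm : Ty₂ A) : typeOf D (twH A a Ψm) = rt c (D.ι a) (typeOf D Ψm) := by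
  apply ty_injective D
  rw [ty_typeOf, ty_rt_ι, ty_typeOf]

omit [DecidableEq A] in
/-- Types of swap-twisted labels: `typeOf (twX Ψm) = (typeOf Ψm)·x⁻¹`. [folklore] -/
theorem typeOf_twX (Ψm : Ty₂ A) : typeOf D (twX A Ψm) = rt c D.x (typeOf D Ψm) := by
  apply ty_injective D
  rw [ty_typeOf, ty_rt_x, ty_typeOf]

omit [DecidableEq A] in
/-- Types of conjugate labels: `typeOf (conj Ψm) = (typeOf Ψm)·c`. [folklore] -/
theorem typeOf_conj (Ψm : Ty₂ A) : typeOf D (conj A Ψm) = rt c c (typeOf D Ψm) := by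
  apply ty_injective D
  rw [ty_typeOf, ty_rt_c, ty_typeOf]

end

end Summit.HodgeConjecture.CorCM.Census.DicyclicTwist
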